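import Literature.Analysis.FluidPDE.NewtonPotential
import HarnessLib

/-!
# Mean value and gradient formulas for functions harmonic on a ball of `(EuclideanSpace ℝ (Fin 3))`

Analysis/FluidPDE support file (theorems only) for the decomposition of the named fact
`Literature.Analysis.FluidPDE.tsai1998_lemma32` (Tsai 1998, Lemma 3.2: polynomial growth of the
pressure of a Leray profile). The local control of the pressure there rests on interior
gradient estimates for a function `h` which is harmonic **on a ball only** (the difference of
the pressure and a localised Newtonian potential), whereas the mean value property of the tree
(`FluidPDE/HarmonicMeanValue`, `FluidPDE/HarmonicProbe`: `integral_radial_mul_harmonic`,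
`integral_probeBump_mul_comp_sub`, `fderiv_harmonic_eq_integral_probeBump`) is stated for
functions harmonic on the whole space. This file proves the local versions on
`(EuclideanSpace ℝ (Fin 3)) = EuclideanSpace ℝ (Fin 3)`, with the smooth compactly supported radial weight
`λ = λ^{r₀,r₁} = Δ((1 − θ)Γ)` of `FluidPDE/NewtonKernel` (`newtonFarLaplacian r₀ r₁`: supported in
the annulus `r₀ ≤ |z| ≤ r₁`, total mass `1`), directly from the localised Green representation
formula `∫ Γ₀ Δφ = φ(0) − ∫ λ φ` of `FluidPDE/NewtonPotential`
(`integral_newtonNear_mul_laplacian`; `Γ₀ = θΓ` is supported in `|z| ≤ r₁`):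

* `eq_integral_newtonFarLaplacian_mul_of_laplacian_eq_zero` — **mean value property on a ball**:
  if `h ∈ C²((EuclideanSpace ℝ (Fin 3)))` and `Δh = 0` on the open ball `B(y, r₁)`, then `h(y) = ∫ λ(z) h(y − z) dz`
  (Gilbarg–Trudinger, Thm 2.1, in the weighted radial form; the weight only sees `B̄(y, r₁)`).
* `fderiv_apply_eq_integral_fderiv_newtonFarLaplacian_mul` — **gradient formula**: if moreover
  `Δh = 0` on a slightly larger ball `B(y, ρ)`, `ρ > r₁`, then
  `Dh(y) a = ∫ ∂ₐλ(z) h(y − z) dz = ∫ λ(z) ∂ₐh(y − z) dz` (differentiate the mean value identity,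
  which holds on a neighbourhood of `y`, under the integral sign and integrate by parts;
  Gilbarg–Trudinger (2.19)/Thm 2.10 in integrated form).
* `abs_fderiv_apply_le_of_laplacian_eq_zero` — the resulting **interior gradient bound**
  `|Dh(y) a| ≤ ‖a‖ · M₁ · ∫_{B̄(y, r₁)} |h|` with `M₁ = sup ‖Dλ‖`.

Everything is proved; no definitions, no named facts.

## References

* D. Gilbarg, N. S. Trudinger, *Elliptic partial differential equations of second order*
  (2001), Thm 2.1 (mean value), (2.17) (Green's representation), Thm 2.10 (interior derivative
  estimates) [GilbargTrudinger2001].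
* T.-P. Tsai, *On Leray's self-similar solutions of the Navier–Stokes equations satisfying local
  energy estimates*, Arch. Rational Mech. Anal. 143 (1998), §2–§3 [Tsai1998].
-/

noncomputable section

open MeasureTheory Set Filter Metric Topology InnerProductSpace Function Real
open scoped RealInnerProductSpace Laplacian ContDiff

namespace Literature.Analysis.FluidPDE

section BallMeanValue

variable {r₀ r₁ : ℝ}

/-- **Mean value property on a ball** (weighted radial form): if `h ∈ C²((EuclideanSpace ℝ (Fin 3)))` is harmonic on
the open ball `B(y, r₁)`, then `h(y) = ∫ λ^{r₀,r₁}(z) h(y − z) dz`, `0 < r₀ < r₁`. (Apply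
`∫ Γ₀ Δφ = φ(0) − ∫ λ φ` to `φ = h(y − ·)`: the left-hand side vanishes because `Γ₀` is
supported in `|z| ≤ r₁` and `Δφ(z) = Δh(y − z) = 0` for `|z| < r₁`.)
[cite: GilbargTrudinger2001, Thm 2.1] -/
theorem eq_integral_newtonFarLaplacian_mul_of_laplacian_eq_zero (h₀ : 0 < r₀) (h₁ : r₀ < r₁)
    {h : (EuclideanSpace ℝ (Fin 3)) → ℝ} (hh : ContDiff ℝ 2 h) {y : (EuclideanSpace ℝ (Fin 3))} (hΔ : ∀ w ∈ ball y r₁, (Δ h) w = 0) :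
    h y = ∫ z, newtonFarLaplacian r₀ r₁ z * h (y - z) := by
  set φ : (EuclideanSpace ℝ (Fin 3)) → ℝ := fun z => h (y - z) with hφ
  have hφ2 : ContDiff ℝ 2 φ := hh.comp (contDiff_const.sub contDiff_id)
  have key := integral_newtonNear_mul_laplacian h₀ h₁ hφ2
  have hzero : ∫ z, newtonNear r₀ r₁ z * (Δ φ) z = 0 := by
    refine integral_eq_zero_of_ae (Eventually.of_forall fun z => ?_)
    show newtonNear r₀ r₁ z * (Δ φ) z = 0
    by_cases hz : ‖z‖ < r₁
    · have hw : y - z ∈ ball y r₁ := by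
        rw [mem_ball, dist_eq_norm, sub_sub_cancel_left, norm_neg]
        exact hz
      rw [hφ, laplacian_comp_const_sub, hΔ _ hw, mul_zero]
    · rw [newtonNear_eq_zero h₀.le h₁ (not_lt.1 hz), zero_mul]
  rw [hzero] at key
  have hφ0 : φ 0 = h y := by simp [hφ]
  rw [hφ0] at key
  linarith

/-- **Gradient formula on a ball**: if `h ∈ C²((EuclideanSpace ℝ (Fin 3)))` is harmonic on `B(y, ρ)` with `ρ > r₁`, then
`Dh(y) a = ∫ ∂ₐλ^{r₀,r₁}(z) h(y − z) dz` (the mean value identity holds at every centre `y'`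
near `y`; differentiate under the integral sign and integrate by parts).
[cite: GilbargTrudinger2001, Thm 2.10] -/
theorem fderiv_apply_eq_integral_fderiv_newtonFarLaplacian_mul (h₀ : 0 < r₀) (h₁ : r₀ < r₁)
    {h : (EuclideanSpace ℝ (Fin 3)) → ℝ} (hh : ContDiff ℝ 2 h) {y : (EuclideanSpace ℝ (Fin 3))} {ρ : ℝ} (hρ : r₁ < ρ)
    (hΔ : ∀ w ∈ ball y ρ, (Δ h) w = 0) (a : (EuclideanSpace ℝ (Fin 3))) :
    fderiv ℝ h y a = ∫ z, fderiv ℝ (newtonFarLaplacian r₀ r₁) z a * h (y - z) := by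
  have hh1 : ContDiff ℝ 1 h := hh.of_le one_le_two
  set lam := newtonFarLaplacian r₀ r₁ with hlam
  have hli : Integrable lam := integrable_newtonFarLaplacian h₀ h₁
  have hl0 : ∀ z : (EuclideanSpace ℝ (Fin 3)), r₁ < ‖z‖ → lam z = 0 := fun z hz =>
    newtonFarLaplacian_eq_zero_of_gt h₀.le h₁ hz
  -- the mean value identity on a neighbourhood of `y`
  have hmv : h =ᶠ[𝓝 y] fun y' => ∫ z, lam z • h (y' - z) := by
    filter_upwards [ball_mem_nhds y (sub_pos.2 hρ)] with y' hy'
    have hsub : ball y' r₁ ⊆ ball y ρ := by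
      refine ball_subset_ball' ?_
      rw [mem_ball] at hy'
      linarith
    simpa only [smul_eq_mul] using
      eq_integral_newtonFarLaplacian_mul_of_laplacian_eq_zero h₀ h₁ hh fun w hw => hΔ w (hsub hw)
  rw [hmv.fderiv_eq, fderiv_integral_smul_comp_sub_apply hli hl0 hh1 y a]
  simp only [smul_eq_mul]
  exact (integral_fderiv_mul_comp_sub (contDiff_newtonFarLaplacian h₀ h₁)
    (hasCompactSupport_newtonFarLaplacian h₀.le h₁) hh1 y a).symm

/-- The same gradient formula with the derivative on `h`: `Dh(y) a = ∫ λ(z) ∂ₐh(y − z) dz`.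
[cite: GilbargTrudinger2001, Thm 2.10] -/
theorem fderiv_apply_eq_integral_newtonFarLaplacian_mul_fderiv (h₀ : 0 < r₀) (h₁ : r₀ < r₁)
    {h : (EuclideanSpace ℝ (Fin 3)) → ℝ} (hh : ContDiff ℝ 2 h) {y : (EuclideanSpace ℝ (Fin 3))} {ρ : ℝ} (hρ : r₁ < ρ)
    (hΔ : ∀ w ∈ ball y ρ, (Δ h) w = 0) (a : (EuclideanSpace ℝ (Fin 3))) :
    fderiv ℝ h y a = ∫ z, newtonFarLaplacian r₀ r₁ z * fderiv ℝ h (y - z) a := by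
  rw [fderiv_apply_eq_integral_fderiv_newtonFarLaplacian_mul h₀ h₁ hh hρ hΔ a]
  exact integral_fderiv_mul_comp_sub (contDiff_newtonFarLaplacian h₀ h₁)
    (hasCompactSupport_newtonFarLaplacian h₀.le h₁) (hh.of_le one_le_two) y a

/-- A uniform bound for the gradient of the weight `λ^{r₀,r₁}` (smooth with compact support).
[folklore] -/
theorem exists_bound_fderiv_newtonFarLaplacian (h₀ : 0 < r₀) (h₁ : r₀ < r₁) :
    ∃ M : ℝ, 0 ≤ M ∧ ∀ z : (EuclideanSpace ℝ (Fin 3)), ‖fderiv ℝ (newtonFarLaplacian r₀ r₁) z‖ ≤ M := by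
  obtain ⟨M, hM⟩ := ((contDiff_newtonFarLaplacian h₀ h₁ (n := 1)).continuous_fderiv
    one_ne_zero).bounded_above_of_compact_support
    ((hasCompactSupport_newtonFarLaplacian h₀.le h₁).fderiv (𝕜 := ℝ))
  exact ⟨max M 0, le_max_right _ _, fun z => (hM z).trans (le_max_left _ _)⟩

/-- **Interior gradient bound on a ball**: if `h ∈ C²((EuclideanSpace ℝ (Fin 3)))` is harmonic on `B(y, ρ)`, `ρ > r₁`,
and `‖Dλ^{r₀,r₁}‖ ≤ M`, then `|Dh(y) a| ≤ ‖a‖ M ∫_{B̄(y, r₁)} |h|`.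
[cite: GilbargTrudinger2001, Thm 2.10] -/
theorem abs_fderiv_apply_le_of_laplacian_eq_zero (h₀ : 0 < r₀) (h₁ : r₀ < r₁)
    {h : (EuclideanSpace ℝ (Fin 3)) → ℝ} (hh : ContDiff ℝ 2 h) {y : (EuclideanSpace ℝ (Fin 3))} {ρ : ℝ} (hρ : r₁ < ρ)
    (hΔ : ∀ w ∈ ball y ρ, (Δ h) w = 0) {M : ℝ}
    (hM : ∀ z : (EuclideanSpace ℝ (Fin 3)), ‖fderiv ℝ (newtonFarLaplacian r₀ r₁) z‖ ≤ M) (a : (EuclideanSpace ℝ (Fin 3))) :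
    |fderiv ℝ h y a| ≤ ‖a‖ * M * ∫ w in closedBall y r₁, |h w| := by
  have hM0 : 0 ≤ M := (norm_nonneg _).trans (hM 0)
  rw [fderiv_apply_eq_integral_fderiv_newtonFarLaplacian_mul h₀ h₁ hh hρ hΔ a]
  -- change variables `w = y - z`
  have hcv : ∫ z, fderiv ℝ (newtonFarLaplacian r₀ r₁) z a * h (y - z) =
      ∫ w, fderiv ℝ (newtonFarLaplacian r₀ r₁) (y - w) a * h w := by
    rw [← integral_sub_left_eq_self (fun z => fderiv ℝ (newtonFarLaplacian r₀ r₁) z a * h (y - z))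
      volume y]
    refine integral_congr_ae (Eventually.of_forall fun w => ?_)
    simp only [sub_sub_cancel]
  rw [hcv]
  -- pointwise domination by the indicator of the closed ball
  have hdom : ∀ w, ‖fderiv ℝ (newtonFarLaplacian r₀ r₁) (y - w) a * h w‖ ≤
      (closedBall y r₁).indicator (fun w => ‖a‖ * M * |h w|) w := by
    intro w
    by_cases hw : w ∈ closedBall y r₁
    · rw [indicator_of_mem hw, norm_mul, Real.norm_eq_abs, Real.norm_eq_abs]
      gcongr
      calc |fderiv ℝ (newtonFarLaplacian r₀ r₁) (y - w) a|
          ≤ ‖fderiv ℝ (newtonFarLaplacian r₀ r₁) (y - w)‖ * ‖a‖ := by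
            rw [← Real.norm_eq_abs]; exact ContinuousLinearMap.le_opNorm _ _
        _ ≤ M * ‖a‖ := by gcongr; exact hM _
        _ = ‖a‖ * M := mul_comm _ _
    · rw [indicator_of_notMem hw]
      have hw' : r₁ < ‖y - w‖ := by
        rw [mem_closedBall, dist_eq_norm, not_le, ← norm_neg, neg_sub] at hw
        exact hw
      have : fderiv ℝ (newtonFarLaplacian r₀ r₁) (y - w) = 0 := by
        refine fderiv_of_notMem_tsupport ℝ fun hmem => ?_
        have := tsupport_newtonFarLaplacian_subset h₀.le h₁ hmem
        rw [mem_closedBall_zero_iff] at this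
        linarith
      rw [this, _root_.zero_apply, zero_mul, norm_zero]
  have hhi : IntegrableOn (fun w => |h w|) (closedBall y r₁) :=
    (hh.continuous.abs.continuousOn).integrableOn_compact (isCompact_closedBall y r₁)
  calc |∫ w, fderiv ℝ (newtonFarLaplacian r₀ r₁) (y - w) a * h w|
      ≤ ∫ w, ‖fderiv ℝ (newtonFarLaplacian r₀ r₁) (y - w) a * h w‖ := by
        rw [← Real.norm_eq_abs]; exact norm_integral_le_integral_norm _
    _ ≤ ∫ w, (closedBall y r₁).indicator (fun w => ‖a‖ * M * |h w|) w := by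
        refine integral_mono_of_nonneg (Eventually.of_forall fun w => norm_nonneg _) ?_
          (Eventually.of_forall hdom)
        exact IntegrableOn.integrable_indicator
          (show IntegrableOn (fun w => ‖a‖ * M * |h w|) (closedBall y r₁) volume from
            hhi.const_mul (‖a‖ * M)) measurableSet_closedBall
    _ = ‖a‖ * M * ∫ w in closedBall y r₁, |h w| := by
        rw [integral_indicator measurableSet_closedBall, integral_const_mul]

end BallMeanValue

end Literature.Analysis.FluidPDE

end
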